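import Literature.NumberTheory.Sieve.RosserSieveSums
import Literature.NumberTheory.Sieve.RosserSievePartialSummation
import Literature.NumberTheory.Sieve.SieveFunctionsConstruction
import HarnessLib

/-!
# Rosser's sieve: the recurrences (4.3), (4.6) and (7.3) for the sums `T_n` and their continuous models

Topic `Literature/NumberTheory/Sieve`; fourth file on Iwaniec, *Rosser's sieve*, Acta Arith. 36 (1980),
after `SieveFunctions.lean`, `RosserSieveMainTerm.lean`, `RosserSieveSums.lean` (the sums
`T_n(D, P) = BetaSieve.bdrySum`, their partial sums `BetaSieve.discT`, the continuous models
`BetaSieve.contS` of (7.1) and their partial sums `BetaSieve.contT`, and the reduction of Theorem 1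
to Lemmas 18 and 20) and `RosserSievePartialSummation.lean` (Lemma 21). It PROVES the remaining
displayed identities of §4 and §7 that the inductive proof of Lemma 20 (§8) manipulates, and the
regularity of the continuous models asserted on pp. 193 and 199:

* `BetaSieve.sum_primes_mul_vprod_eq` — Buchstab telescoping
  `∑_{w ≤ p < z} g(p) V(P(p)) = V(P(w)) − V(P(z))` (Greaves (4.1.2.5));
* `BetaSieve.bdrySum_one_one_eq` — (4.3)/(8.3): `T⁺_1(y, P(z)) = V(P(y^{1/(β+1)})) − V(P(z))` for
  `y^{1/(β+1)} ≤ z`; `bdrySum_zero_one_eq` (`T⁻_1 = 0`);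
* `BetaSieve.bdrySum_one_one_le` — (8.3), the case `R = 0` of Lemma 20:
  `T⁺_1(y, P(z)) ≤ V(P(z)) s^{−κ} {(β + 1)^κ − s^κ + L (β + 1)^{κ+1}/log y}` for `2 ≤ y^{1/(β+1)} ≤ z`;
* `BetaSieve.bdrySum_one_succ_succ_eq`, `discT_one_eq_add` — (4.6):
  `T⁺_{R,z}(s) = T⁺_{0,z}(s) + T⁺_{R,z₁}(β + 1)`, `z₁ = y^{1/(β+1)} ≤ z`;
* the kernel `k(t) = κ t^{κ−1} (t − 1)^{−κ}` of (7.1) is `BetaSieveForward.sieveKernel`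
  (`SieveFunctionsConstruction.lean`), `= κ (1 − 1/t)^{−κ}/t` (`BetaSieve.sieveKernel_eq_of_one_lt`);
  for
  `β > 1`, `κ ≥ 0`: `continuous_contS`, `continuous_contT` (p. 193), `contS_antitoneOn`,
  `contT_antitoneOn` (p. 199: "`T^±_R(s)` are decreasing"), `contS_succ_succ_eq_integral` (the printed
  `∫_s^∞` form of (7.1)), and **(7.3)**: `contT_zero_succ_eq_integral`
  (`T⁻_R(s) = ∫_s^∞ k(t) T⁺_{R−1}(t − 1) dt`, `s ≥ β`), `contT_one_succ_eq_integral`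
  (`T⁺_R(s) = ∫_s^∞ k(t) T⁻_R(t − 1) dt`, `s ≥ β + 1`), with finite upper limits beyond the support;
  the third line of (7.3) is `BetaSieve.contT_one_eq_of_le` in `RosserSieveSums.lean`.

## References

* H. Iwaniec, *Rosser's sieve*, Acta Arith. 36 (1980), 171–202: (4.3), (4.6), §7 (7.1)–(7.3), p. 193,
  §8 (8.3), p. 199. [IwaniecActaArith1980]
* G. Greaves, *Sieves in Number Theory*, Springer (2001), §4.1.2 (2.5). [Greaves2001]

## Design notes

* The regularity statements assume `β > 1` (so that all lower limits exceed `1` and the kernel is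
  continuous on the ranges of integration; Iwaniec's `β_κ > 1` for `κ > 1/2`); the case `β = 1`
  (`κ ≤ 1/2`, kernel integrable but singular at `t = 1`) is not treated here.
* Infinite upper limits `∫_s^∞` are replaced by any finite `U` beyond the support of the integrand
  (`integral_max_eq_integral_of_eq_zero`).
-/

open Finset Filter Set MeasureTheory intervalIntegral
open scoped ArithmeticFunction.Moebius ArithmeticFunction.omega

noncomputable section

namespace Literature.NumberTheory.Sieve

open BetaSieveForward (sieveKernel sieveKernel_nonneg continuousOn_sieveKernel)

namespace BetaSieve

variable {g : ArithmeticFunction ℝ} {κ β : ℝ}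

/-! ### Telescoping of `V(P(·))` over the primes of an interval -/

/-- **Buchstab telescoping** (the difference of two instances of Greaves (4.1.2.5),
`V(P(z)) = 1 − ∑_{p < z} g(p) V(P(p))`; Iwaniec (4.3), second equality):
`∑_{w ≤ p < z} g(p) V(P(p)) = V(P(w)) − V(P(z))` for `w ≤ z`. [cite: Greaves2001, §4.1.2 (2.5)] -/
theorem sum_primes_mul_vprod_eq (w z : ℝ) (hwz : w ≤ z) :
    ∑ p ∈ Nat.primesBelow ⌈z⌉₊ with w ≤ ((p : ℕ) : ℝ), g p * vprod g (primesProdBelow p) =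
      vprod g (primesProdBelow w) - vprod g (primesProdBelow z) := by
  have h := sum_primes_eq_sum_Ico (g := g) w z (fun _ => 1)
  simp only [mul_one] at h
  rw [h, Finset.sum_Ico_eq_sum_range]
  have hab : ⌈w⌉₊ ≤ ⌈z⌉₊ := Nat.ceil_mono hwz
  have htel := Finset.sum_range_sub' (fun i => vprod g (primesProdBelow ((⌈w⌉₊ + i : ℕ) : ℝ)))
    (⌈z⌉₊ - ⌈w⌉₊)
  rw [show ⌈w⌉₊ + (⌈z⌉₊ - ⌈w⌉₊) = ⌈z⌉₊ by omega] at htel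
  have e1 : ∀ i, ((⌈w⌉₊ + i + 1 : ℕ) : ℝ) = ((⌈w⌉₊ + (i + 1) : ℕ) : ℝ) := fun i => by push_cast; ring
  simp only [e1] at htel ⊢
  rw [htel]
  -- `P(⌈w⌉₊) = P(w)` and `P(⌈z⌉₊) = P(z)`
  have hPw : primesProdBelow ((⌈w⌉₊ + 0 : ℕ) : ℝ) = primesProdBelow w := by
    rw [add_zero, primesProdBelow, primesProdBelow, Nat.ceil_natCast]
  have hPz : primesProdBelow ((⌈z⌉₊ : ℕ) : ℝ) = primesProdBelow z := by
    rw [primesProdBelow, primesProdBelow, Nat.ceil_natCast]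
  rw [hPw, hPz]

/-! ### The first upper sum and the reduction (4.6) -/

/-- **Iwaniec (4.3) / (8.3), first equality**: `T⁺_1(y, P(z)) = V(P(y^{1/(β+1)})) − V(P(z))` when
`y^{1/(β+1)} ≤ z` (`y ≥ 0`, `β + 1 > 0`): the boundary primes of the upper sieve are exactly those with
`p^{β+1} ≥ y`. [cite: IwaniecActaArith1980, (4.3)] -/
theorem bdrySum_one_one_eq {y z : ℝ} (hy : 0 ≤ y) (hβ : 0 < β + 1)
    (hz : y ^ (1 / (β + 1)) ≤ z) :
    bdrySum 1 g β y (primesProdBelow z) 1 =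
      vprod g (primesProdBelow (y ^ (1 / (β + 1)))) - vprod g (primesProdBelow z) := by
  classical
  rw [bdrySum_one_eq, ← sum_primes_mul_vprod_eq _ _ hz, Finset.sum_filter]
  refine Finset.sum_congr rfl fun p hp => ?_
  have hp0 : (0 : ℝ) ≤ p := Nat.cast_nonneg p
  have hiff : y ≤ (p : ℝ) ^ (β + 1) ↔ y ^ (1 / (β + 1)) ≤ (p : ℝ) := by
    rw [one_div, Real.rpow_inv_le_iff_of_pos hy hp0 hβ]
  by_cases h : y ≤ (p : ℝ) ^ (β + 1)
  · rw [if_pos ⟨rfl, h⟩, if_pos (hiff.mp h)]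
  · rw [if_neg (fun h' => h h'.2), if_neg (fun h' => h (hiff.mpr h'))]

/-- The lower sieve has no boundary primes: `T⁻_1 = 0`. [cite: IwaniecActaArith1980, (4.2)] -/
theorem bdrySum_zero_one_eq (y z : ℝ) : bdrySum 0 g β y (primesProdBelow z) 1 = 0 := by
  rw [bdrySum_one_eq]
  exact Finset.sum_eq_zero fun p _ => if_neg fun h => by omega

/-- **Iwaniec (4.6), termwise**: for `n ≥ 2` the upper boundary sums only involve primes
`p₁ < y^{1/(β+1)}`, so `T⁺_n(y, P(z)) = T⁺_n(y, P(y^{1/(β+1)}))` whenever `y^{1/(β+1)} ≤ z`.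
[cite: IwaniecActaArith1980, (4.6)] -/
theorem bdrySum_one_succ_succ_eq (hg : g.IsMultiplicative) {y z : ℝ} (hy : 0 ≤ y) (hβ : 0 < β + 1)
    (hz : y ^ (1 / (β + 1)) ≤ z) (n : ℕ) :
    bdrySum 1 g β y (primesProdBelow z) (n + 2) =
      bdrySum 1 g β y (primesProdBelow (y ^ (1 / (β + 1)))) (n + 2) := by
  classical
  set z₁ := y ^ (1 / (β + 1)) with hz₁
  have key : ∀ w : ℝ, z₁ ≤ w → bdrySum 1 g β y (primesProdBelow w) (n + 2) =
      ∑ p ∈ Nat.primesBelow ⌈z₁⌉₊, g p * bdrySum (1 + 1) g β (y / p) (primesProdBelow p) (n + 1) := by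
    intro w hw
    rw [bdrySum_succ_succ hg]
    have hsub : Nat.primesBelow ⌈z₁⌉₊ ⊆ Nat.primesBelow ⌈w⌉₊ :=
      Nat.primesBelow_mono (Nat.ceil_mono hw)
    rw [← Finset.sum_subset hsub]
    · refine Finset.sum_congr rfl fun p hp => ?_
      have hpz₁ : (p : ℝ) < z₁ := Nat.lt_ceil.mp (Nat.lt_of_mem_primesBelow hp)
      have hcond : (1 % 2 = 1 → (p : ℝ) ^ (β + 1) < y) := fun _ =>
        (Real.lt_rpow_inv_iff_of_pos (Nat.cast_nonneg p) hy hβ).mp (by rwa [← one_div])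
      rw [if_pos hcond]
    · intro p hp hp'
      have hpp := Nat.prime_of_mem_primesBelow hp
      have hge : z₁ ≤ (p : ℝ) := by
        by_contra hlt
        exact hp' (Nat.mem_primesBelow.mpr ⟨Nat.lt_ceil.mpr (not_le.mp hlt), hpp⟩)
      rw [if_neg, zero_mul]
      intro h
      have := (Real.lt_rpow_inv_iff_of_pos (Nat.cast_nonneg p) hy hβ).mpr (h rfl)
      rw [← one_div] at this
      linarith
  rw [key z hz, key z₁ le_rfl]

/-- **Iwaniec (4.6)**: `T⁺_{R,z}(s) = T⁺_{0,z}(s) + T⁺_{R,z₁}(β + 1)`, `z₁ = y^{1/(β+1)} ≤ z`, i.e.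
`∑_{n ≤ N} T⁺_n(y, P(z)) = T⁺_1(y, P(z)) + ∑_{n ≤ N} T⁺_n(y, P(z₁))` for `N ≥ 1` (the term `n = 1` on
the right vanishes: no prime below `z₁` has `p^{β+1} ≥ y`). [cite: IwaniecActaArith1980, (4.6)] -/
theorem discT_one_eq_add (hg : g.IsMultiplicative) {y z : ℝ} (hy : 0 ≤ y) (hβ : 0 < β + 1)
    (hz : y ^ (1 / (β + 1)) ≤ z) {N : ℕ} (hN : 1 ≤ N) :
    discT 1 g β y (primesProdBelow z) N =
      bdrySum 1 g β y (primesProdBelow z) 1 +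
        discT 1 g β y (primesProdBelow (y ^ (1 / (β + 1)))) N := by
  rw [discT, discT]
  have hterm : ∀ n, bdrySum 1 g β y (primesProdBelow z) n =
      (if n = 1 then bdrySum 1 g β y (primesProdBelow z) 1 else 0) +
        bdrySum 1 g β y (primesProdBelow (y ^ (1 / (β + 1)))) n := by
    intro n
    rcases n with _ | _ | n
    · rw [if_neg (by omega), zero_add, bdrySum_zero _ _ _ _ (primesProdBelow_ne_zero _),
        bdrySum_zero _ _ _ _ (primesProdBelow_ne_zero _)]
    · rw [if_pos rfl, bdrySum_one_one_eq (z := y ^ (1 / (β + 1))) hy hβ le_rfl, sub_self, add_zero]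
    · rw [if_neg (by omega), zero_add, bdrySum_one_succ_succ_eq hg hy hβ hz n]
  rw [Finset.sum_congr rfl fun n _ => hterm n, Finset.sum_add_distrib, Finset.sum_ite_eq',
    if_pos (Finset.mem_range.mpr (by omega))]

/-- **Iwaniec (8.3)** (the case `R = 0` of Lemma 20): for `y > 0`, `2 ≤ y^{1/(β+1)} ≤ z`,
`s = log y/log z`,
`T⁺_1(y, P(z)) = V(P(y^{1/(β+1)})) − V(P(z)) ≤ V(P(z)) s^{−κ} {(β + 1)^κ − s^κ + L (β + 1)^{κ+1}/log y}`
(from `Ω(κ, L)` with `w = y^{1/(β+1)}`, `log z/log w = (β + 1)/s`; the constant `K` of Iwaniec's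
(1.3) is replaced by the `L` of `Ω(κ, L)`, and the printed `<` is `≤` here).
[cite: IwaniecActaArith1980, §8 (8.3)] -/
theorem bdrySum_one_one_le {L : ℝ} (hdim : HasIwaniecDimension g κ L) {y z : ℝ} (hy0 : 0 < y)
    (hβ : 0 < β + 1) (hw2 : 2 ≤ y ^ (1 / (β + 1))) (hwz : y ^ (1 / (β + 1)) ≤ z) :
    bdrySum 1 g β y (primesProdBelow z) 1 ≤
      vprod g (primesProdBelow z) * (Real.log y / Real.log z) ^ (-κ) *
        ((β + 1) ^ κ - (Real.log y / Real.log z) ^ κ + L * (β + 1) ^ (κ + 1) / Real.log y) := by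
  set w := y ^ (1 / (β + 1)) with hw
  have hz1 : 1 < z := by linarith
  have hw1 : 1 < w := by linarith
  have hlogz : 0 < Real.log z := Real.log_pos hz1
  have hlogw : Real.log w = Real.log y / (β + 1) := by
    rw [hw, Real.log_rpow hy0]; ring
  have hlogy : 0 < Real.log y := by
    have : 0 < Real.log w := Real.log_pos hw1
    rw [hlogw] at this
    exact (div_pos_iff_of_pos_right hβ).mp this
  set s := Real.log y / Real.log z with hs
  have hs0 : 0 < s := div_pos hlogy hlogz
  have hV := hdim.vprod_le hw2 hwz
  have hVz := hdim.vprod_pos z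
  rw [bdrySum_one_one_eq hy0.le hβ hwz]
  have hratio : Real.log z / Real.log w = (β + 1) / s := by
    rw [hlogw, hs]; field_simp
  rw [hratio, hlogw] at hV
  have e1 : ((β + 1) / s) ^ κ = (β + 1) ^ κ * s ^ (-κ) := by
    rw [Real.div_rpow hβ.le hs0.le, Real.rpow_neg hs0.le, div_eq_mul_inv]
  have e2 : (β + 1) ^ (κ + 1) = (β + 1) ^ κ * (β + 1) := Real.rpow_add_one hβ.ne' κ
  have e3 : s ^ (-κ) * s ^ κ = 1 := by
    rw [Real.rpow_neg hs0.le, inv_mul_cancel₀ (Real.rpow_pos_of_pos hs0 κ).ne']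
  rw [e1] at hV
  have key : vprod g (primesProdBelow w) - vprod g (primesProdBelow z) ≤
      (β + 1) ^ κ * s ^ (-κ) * (1 + L / (Real.log y / (β + 1))) * vprod g (primesProdBelow z) -
        (s ^ (-κ) * s ^ κ) * vprod g (primesProdBelow z) := by
    rw [e3, one_mul]; linarith
  refine key.trans (le_of_eq ?_)
  rw [e2]
  field_simp
  ring

/-! ### The kernel `κ t^{κ−1} (t − 1)^{−κ}` and regularity of the continuous models (`β > 1`) -/

/-- The kernel `k(t) = κ t^{κ−1} (t − 1)^{−κ}` of the recurrences (7.1) is the tree's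
`BetaSieveForward.sieveKernel` (`SieveFunctionsConstruction.lean`); in the form of (7.3):
`k(t) = κ (1 − 1/t)^{−κ} / t` for `t > 1`. [cite: IwaniecActaArith1980, §7 (7.3)] -/
theorem sieveKernel_eq_of_one_lt {κ t : ℝ} (ht : 1 < t) :
    sieveKernel κ t = κ * (1 - 1 / t) ^ (-κ) / t := by
  have ht0 : 0 < t := by linarith
  rw [sieveKernel, show 1 - 1 / t = (t - 1) / t by field_simp, Real.div_rpow (by linarith) ht0.le,
    Real.rpow_neg ht0.le, Real.rpow_sub_one ht0.ne']
  field_simp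

end BetaSieve

/-! ### Generic interval-integral lemmas (clamped primitives, vanishing tails) -/

/-- A clamped primitive `s ↦ ∫_{max(s,c)}^{max(max(s,c),d)} f` equals `u ↦ ∫_u^d f` at
`u = min(max(s, c), d) ∈ [c, d]` (`c ≤ d`). [folklore] -/
theorem clampedIntegral_eq {f : ℝ → ℝ} {c d : ℝ} (hcd : c ≤ d) (s : ℝ) :
    ∫ t in (max s c)..(max (max s c) d), f t = ∫ t in (min (max s c) d)..d, f t := by
  rcases le_or_gt s d with hs | hs
  · have h1 : max s c ≤ d := max_le hs hcd
    rw [max_eq_right h1, min_eq_left h1]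
  · have h1 : d ≤ max s c := le_trans hs.le (le_max_left _ _)
    rw [max_eq_left h1, min_eq_right h1, intervalIntegral.integral_same, intervalIntegral.integral_same]

/-- A clamped primitive of a function continuous on `[c, d]` is continuous on `ℝ`. [folklore] -/
theorem continuous_clampedIntegral {f : ℝ → ℝ} {c d : ℝ} (hcd : c ≤ d) (hf : ContinuousOn f (Icc c d)) :
    Continuous fun s => ∫ t in (max s c)..(max (max s c) d), f t := by
  have hH : ContinuousOn (fun u => ∫ t in u..d, f t) (Icc c d) := by
    have hint : IntegrableOn f (uIcc c d) volume := by
      rw [uIcc_of_le hcd]; exact hf.integrableOn_Icc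
    have h := intervalIntegral.continuousOn_primitive_interval_left hint
    rwa [uIcc_of_le hcd] at h
  have hclamp : Continuous fun s : ℝ => min (max s c) d :=
    (continuous_id.max continuous_const).min continuous_const
  have hmem : ∀ s, min (max s c) d ∈ Icc c d := fun s =>
    ⟨le_min (le_max_right _ _) hcd, min_le_right _ _⟩
  have heq : (fun s => ∫ t in (max s c)..(max (max s c) d), f t) =
      fun s => (fun u => ∫ t in u..d, f t) (min (max s c) d) :=
    funext fun s => clampedIntegral_eq hcd s
  rw [heq]
  exact hH.comp_continuous hclamp hmem

/-- A clamped primitive of a nonnegative function continuous on `[c, d]` is non-increasing.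
[folklore] -/
theorem clampedIntegral_antitone {f : ℝ → ℝ} {c d : ℝ} (hcd : c ≤ d) (hf : ContinuousOn f (Icc c d))
    (hf0 : ∀ t ∈ Icc c d, 0 ≤ f t) :
    Antitone fun s => ∫ t in (max s c)..(max (max s c) d), f t := by
  intro a b hab
  simp only [clampedIntegral_eq hcd]
  set u := min (max a c) d with hu
  set v := min (max b c) d with hv
  have huv : u ≤ v := min_le_min (max_le_max hab le_rfl) le_rfl
  have hcu : c ≤ u := le_min (le_max_right _ _) hcd
  have hvd : v ≤ d := min_le_right _ _
  have hint : ∀ p q, c ≤ p → p ≤ q → q ≤ d → IntervalIntegrable f volume p q := by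
    intro p q hp hpq hq
    refine ContinuousOn.intervalIntegrable ?_
    rw [uIcc_of_le hpq]
    exact hf.mono (Icc_subset_Icc hp hq)
  have hadd := intervalIntegral.integral_add_adjacent_intervals (hint u v hcu huv hvd)
    (hint v d (hcu.trans huv) hvd le_rfl)
  have h0 : 0 ≤ ∫ t in u..v, f t :=
    intervalIntegral.integral_nonneg huv fun t ht => hf0 t ⟨hcu.trans ht.1, ht.2.trans hvd⟩
  linarith

/-- Extending the upper limit over a range where the integrand vanishes. [folklore] -/
theorem integral_max_eq_integral_of_eq_zero {f : ℝ → ℝ} {s b U : ℝ} (hb : ∀ t, b ≤ t → f t = 0)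
    (hU : max s b ≤ U) (hint : IntervalIntegrable f volume s (max s b)) :
    ∫ t in s..(max s b), f t = ∫ t in s..U, f t := by
  have hzero : ∀ t ∈ uIcc (max s b) U, f t = 0 := fun t ht => by
    rw [uIcc_of_le hU] at ht
    exact hb t ((le_max_right _ _).trans ht.1)
  have hint2 : IntervalIntegrable f volume (max s b) U := by
    refine (intervalIntegrable_const (c := (0 : ℝ))).congr fun t ht => ?_
    rw [uIoc_of_le hU] at ht
    exact (hb t ((le_max_right _ _).trans ht.1.le)).symm
  rw [← intervalIntegral.integral_add_adjacent_intervals hint hint2,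
    intervalIntegral.integral_congr (g := fun _ => (0 : ℝ)) (fun t ht => hzero t ht),
    intervalIntegral.integral_zero, add_zero]

namespace BetaSieve

variable {g : ArithmeticFunction ℝ} {κ β : ℝ}

/-- The integrand of `S_{n+2}` is continuous on `[β + ε_n, β + n + 2]` once `S_{n+1}` is continuous
(`β > 1`). [folklore] -/
theorem continuousOn_integrand (hβ : 1 < β) {φ : ℝ → ℝ} (hφ : Continuous φ) (n : ℕ) :
    ContinuousOn (fun t => sieveKernel κ t * φ (t - 1)) (Icc (β + parityShift n) (β + n + 2)) := by
  refine ((continuousOn_sieveKernel κ).mono fun t ht => ?_).mul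
    ((hφ.comp (continuous_id.sub continuous_const)).continuousOn)
  exact lt_of_lt_of_le (by linarith [(parityShift_mem n).1]) ht.1

/-- **Continuity of the continuous models** for `β > 1`, `κ ≥ 0` (Iwaniec, p. 193: "`T^±_R(s)` are
continuous"). [cite: IwaniecActaArith1980, §7 (after (7.2))] -/
theorem continuous_contS (hκ : 0 ≤ κ) (hβ : 1 < β) : ∀ n : ℕ, Continuous (contS κ β n)
  | 0 => by
    rw [show contS κ β 0 = fun _ => 0 from funext fun s => contS_zero κ β s]
    exact continuous_const
  | 1 => by
    rw [show contS κ β 1 = fun s => (β + 1) ^ κ - (min s (β + 1)) ^ κ from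
      funext fun s => contS_one κ β s]
    exact continuous_const.sub
      ((Real.continuous_rpow_const hκ).comp (continuous_id.min continuous_const))
  | n + 2 => by
    have ih := continuous_contS hκ hβ (n + 1)
    have hcd : β + parityShift n ≤ β + n + 2 := by
      have := (parityShift_mem n).2
      have : (0 : ℝ) ≤ n := Nat.cast_nonneg n
      linarith
    have h := continuous_clampedIntegral hcd (continuousOn_integrand (κ := κ) hβ ih n)
    rw [show contS κ β (n + 2) = fun s =>
        ∫ t in (max s (β + parityShift n))..(max (max s (β + parityShift n)) (β + n + 2)),
          sieveKernel κ t * contS κ β (n + 1) (t - 1) from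
        funext fun s => contS_succ_succ κ β n s]
    exact h

/-- The partial sums `T^±_N` are continuous (`β > 1`, `κ ≥ 0`).
[cite: IwaniecActaArith1980, §7 (after (7.2))] -/
theorem continuous_contT (hκ : 0 ≤ κ) (hβ : 1 < β) (par N : ℕ) : Continuous (contT par κ β N) := by
  rw [show contT par κ β N = fun s => ∑ n ∈ (Finset.range (N + 1)).filter (fun n => n % 2 = par % 2),
      contS κ β n s from funext fun s => rfl]
  exact continuous_finsetSum _ fun n _ => continuous_contS hκ hβ n

/-- **Monotonicity of the continuous models**: each `S_n` is non-increasing on `[0, ∞)` (`β > 1`,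
`κ ≥ 0`; for `n ≥ 2` on all of `ℝ`): the integrands are nonnegative and the lower limit increases with
`s` (Iwaniec, p. 199: "`T^±_R(s)` are decreasing"). [cite: IwaniecActaArith1980, §8 (after (8.8))] -/
theorem contS_succ_succ_antitone (hκ : 0 ≤ κ) (hβ : 1 < β) (n : ℕ) : Antitone (contS κ β (n + 2)) := by
  have hcd : β + parityShift n ≤ β + n + 2 := by
    have := (parityShift_mem n).2
    have : (0 : ℝ) ≤ n := Nat.cast_nonneg n
    linarith
  have h := clampedIntegral_antitone hcd
    (continuousOn_integrand (κ := κ) hβ (continuous_contS hκ hβ (n + 1)) n) fun t ht => ?_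
  · rw [show contS κ β (n + 2) = fun s =>
        ∫ t in (max s (β + parityShift n))..(max (max s (β + parityShift n)) (β + n + 2)),
          sieveKernel κ t * contS κ β (n + 1) (t - 1) from
        funext fun s => contS_succ_succ κ β n s]
    exact h
  · have h0 := (parityShift_mem n).1
    exact mul_nonneg (sieveKernel_nonneg hκ (by linarith [ht.1]))
      (contS_nonneg hκ hβ.le (n + 1) (by linarith [ht.1]))

/-- `S_n` is non-increasing on `[0, ∞)` for every `n` (`β > 1`, `κ ≥ 0`).
[cite: IwaniecActaArith1980, §8 (after (8.8))] -/
theorem contS_antitoneOn (hκ : 0 ≤ κ) (hβ : 1 < β) : ∀ n : ℕ, AntitoneOn (contS κ β n) (Ici 0)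
  | 0 => fun _ _ _ _ _ => by rw [contS_zero, contS_zero]
  | 1 => by
    intro a ha b _ hab
    rw [contS_one, contS_one]
    have : (min a (β + 1)) ^ κ ≤ (min b (β + 1)) ^ κ :=
      Real.rpow_le_rpow (le_min ha (by linarith)) (min_le_min hab le_rfl) hκ
    linarith
  | n + 2 => (contS_succ_succ_antitone hκ hβ n).antitoneOn _

/-- `T^±_N` is non-increasing on `[0, ∞)` (`β > 1`, `κ ≥ 0`).
[cite: IwaniecActaArith1980, §8 (after (8.8))] -/
theorem contT_antitoneOn (hκ : 0 ≤ κ) (hβ : 1 < β) (par N : ℕ) :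
    AntitoneOn (contT par κ β N) (Ici 0) := by
  intro a ha b hb hab
  exact Finset.sum_le_sum fun n _ => contS_antitoneOn hκ hβ n ha hb hab

/-! ### The integral recurrences (7.3) for the partial sums -/

/-- `T^{par}_{N+1} = T^{par}_N + [N + 1 ≡ par] S_{N+1}`. [folklore] -/
theorem contT_succ (par : ℕ) (κ β : ℝ) (N : ℕ) (s : ℝ) :
    contT par κ β (N + 1) s =
      contT par κ β N s + if (N + 1) % 2 = par % 2 then contS κ β (N + 1) s else 0 := by
  unfold contT
  rw [Finset.sum_filter, Finset.sum_filter, Finset.sum_range_succ]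

/-- Integrability of `k(t) φ(t − 1)` on `[s, U]`, `s > 1`, for continuous `φ`. [folklore] -/
theorem intervalIntegrable_sieveKernel_mul {φ : ℝ → ℝ} (hφ : Continuous φ) {s U : ℝ} (hs : 1 < s)
    (hsU : s ≤ U) : IntervalIntegrable (fun t => sieveKernel κ t * φ (t - 1)) volume s U := by
  refine ContinuousOn.intervalIntegrable ?_
  rw [uIcc_of_le hsU]
  exact ((continuousOn_sieveKernel κ).mono fun t ht => lt_of_lt_of_le hs ht.1).mul
    ((hφ.comp (continuous_id.sub continuous_const)).continuousOn)

/-- `S_{m+2}(s) = ∫_s^U k(t) S_{m+1}(t − 1) dt` for `s ≥ β + ε_m` and any `U ≥ max(s, β + m + 2)`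
(`β > 1`, `κ ≥ 0`): the printed form `∫_s^∞` of (7.1). [cite: IwaniecActaArith1980, §7 (7.1)] -/
theorem contS_succ_succ_eq_integral (hκ : 0 ≤ κ) (hβ : 1 < β) (m : ℕ) {s U : ℝ}
    (hs : β + parityShift m ≤ s) (hU : max s (β + m + 2) ≤ U) :
    contS κ β (m + 2) s = ∫ t in s..U, sieveKernel κ t * contS κ β (m + 1) (t - 1) := by
  have h0 := (parityShift_mem m).1
  have hs1 : 1 < s := by linarith
  have e : contS κ β (m + 2) s =
      ∫ t in (max s (β + parityShift m))..(max (max s (β + parityShift m)) (β + m + 2)),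
        sieveKernel κ t * contS κ β (m + 1) (t - 1) := contS_succ_succ κ β m s
  rw [e, max_eq_left hs]
  refine integral_max_eq_integral_of_eq_zero (fun t ht => ?_) hU
    (intervalIntegrable_sieveKernel_mul (continuous_contS hκ hβ (m + 1)) hs1 (le_max_left _ _))
  rw [contS_eq_zero_of_le (by omega) (by push_cast; linarith), mul_zero]

/-- **(7.3), first line**: `T⁻_R(s) = κ ∫_s^∞ (1 − 1/t)^{−κ} T⁺_{R−1}(t − 1) dt/t` for `s ≥ β`, here
for the partial sums `T⁻ = contT 0 κ β (N + 1)`, `T⁺ = contT 1 κ β N` and any finite upper limit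
`U ≥ max(s, β + N + 1)` beyond the support (`β > 1`, `κ ≥ 0`; `k(t) = κ (1 − 1/t)^{−κ}/t`,
`sieveKernel_eq_of_one_lt`). [cite: IwaniecActaArith1980, §7 (7.3)] -/
theorem contT_zero_succ_eq_integral (hκ : 0 ≤ κ) (hβ : 1 < β) :
    ∀ (N : ℕ) {s U : ℝ}, β ≤ s → max s (β + N + 1) ≤ U →
      contT 0 κ β (N + 1) s = ∫ t in s..U, sieveKernel κ t * contT 1 κ β N (t - 1)
  | 0, s, U, hs, hU => by
    rw [contT_succ, contT_zero_right, if_neg (by omega), add_zero]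
    simp only [contT_zero_right, mul_zero, intervalIntegral.integral_zero]
  | N + 1, s, U, hs, hU => by
    have hs1 : 1 < s := by linarith
    have hsU : s ≤ U := (le_max_left _ _).trans hU
    have ih := contT_zero_succ_eq_integral hκ hβ N hs
      ((max_le_max le_rfl (by push_cast; linarith)).trans hU)
    rw [contT_succ, ih]
    have hsplit : ∫ t in s..U, sieveKernel κ t * contT 1 κ β (N + 1) (t - 1) =
        (∫ t in s..U, sieveKernel κ t * contT 1 κ β N (t - 1)) +
          ∫ t in s..U, sieveKernel κ t *
            (if (N + 1) % 2 = 1 % 2 then contS κ β (N + 1) (t - 1) else 0) := by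
      rw [← intervalIntegral.integral_add
        (intervalIntegrable_sieveKernel_mul (continuous_contT hκ hβ 1 N) hs1 hsU)]
      · refine intervalIntegral.integral_congr fun t _ => ?_
        simp only [contT_succ]
        ring
      · split_ifs
        · exact intervalIntegrable_sieveKernel_mul (continuous_contS hκ hβ (N + 1)) hs1 hsU
        · simp only [mul_zero]; exact intervalIntegrable_const
    rw [hsplit]
    congr 1
    by_cases hpar : (N + 1 + 1) % 2 = 0 % 2
    · -- `N` even: the new term `S_{N+2}(s) = ∫_s^U k S_{N+1}(t-1)`
      have hc : (N + 1) % 2 = 1 % 2 := by omega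
      rw [if_pos hpar]
      simp only [if_pos hc]
      refine contS_succ_succ_eq_integral hκ hβ N
        (by rw [parityShift_of_even (by omega)]; linarith) (max_le hsU ?_)
      have := le_max_right s (β + ((N : ℝ) + 1) + 1)
      push_cast at hU ⊢
      linarith
    · have hc : ¬ (N + 1) % 2 = 1 % 2 := by omega
      rw [if_neg hpar]
      simp only [if_neg hc, mul_zero, intervalIntegral.integral_zero]

/-- **(7.3), second line**: `T⁺_R(s) = κ ∫_s^∞ (1 − 1/t)^{−κ} T⁻_R(t − 1) dt/t` for `s ≥ β + 1`, for
the partial sums `T⁺ = contT 1 κ β (N + 1)`, `T⁻ = contT 0 κ β N` and any `U ≥ max(s, β + N + 1)`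
(`β > 1`, `κ ≥ 0`). [cite: IwaniecActaArith1980, §7 (7.3)] -/
theorem contT_one_succ_eq_integral (hκ : 0 ≤ κ) (hβ : 1 < β) :
    ∀ (N : ℕ) {s U : ℝ}, β + 1 ≤ s → max s (β + N + 1) ≤ U →
      contT 1 κ β (N + 1) s = ∫ t in s..U, sieveKernel κ t * contT 0 κ β N (t - 1)
  | 0, s, U, hs, hU => by
    rw [contT_succ, contT_zero_right, if_pos (by omega), zero_add,
      contS_eq_zero_of_le le_rfl (by push_cast; linarith)]
    simp only [contT_zero_right, mul_zero, intervalIntegral.integral_zero]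
  | N + 1, s, U, hs, hU => by
    have hs1 : 1 < s := by linarith
    have hsU : s ≤ U := (le_max_left _ _).trans hU
    have ih := contT_one_succ_eq_integral hκ hβ N hs
      ((max_le_max le_rfl (by push_cast; linarith)).trans hU)
    rw [contT_succ, ih]
    have hsplit : ∫ t in s..U, sieveKernel κ t * contT 0 κ β (N + 1) (t - 1) =
        (∫ t in s..U, sieveKernel κ t * contT 0 κ β N (t - 1)) +
          ∫ t in s..U, sieveKernel κ t *
            (if (N + 1) % 2 = 0 % 2 then contS κ β (N + 1) (t - 1) else 0) := by
      rw [← intervalIntegral.integral_add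
        (intervalIntegrable_sieveKernel_mul (continuous_contT hκ hβ 0 N) hs1 hsU)]
      · refine intervalIntegral.integral_congr fun t _ => ?_
        simp only [contT_succ]
        ring
      · split_ifs
        · exact intervalIntegrable_sieveKernel_mul (continuous_contS hκ hβ (N + 1)) hs1 hsU
        · simp only [mul_zero]; exact intervalIntegrable_const
    rw [hsplit]
    congr 1
    by_cases hpar : (N + 1 + 1) % 2 = 1 % 2
    · -- `N` odd: the new term `S_{N+2}(s) = ∫_s^U k S_{N+1}(t-1)` (lower limit `max(s, β+1) = s`)
      have hc : (N + 1) % 2 = 0 % 2 := by omega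
      rw [if_pos hpar]
      simp only [if_pos hc]
      refine contS_succ_succ_eq_integral hκ hβ N
        (by rw [parityShift_of_odd (by omega)]; linarith) (max_le hsU ?_)
      have := le_max_right s (β + ((N : ℝ) + 1) + 1)
      push_cast at hU ⊢
      linarith
    · have hc : ¬ (N + 1) % 2 = 0 % 2 := by omega
      rw [if_neg hpar]
      simp only [if_neg hc, mul_zero, intervalIntegral.integral_zero]

end BetaSieve

end Literature.NumberTheory.Sieve
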